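import Literature.AlgebraicGeometry.Resolution.LogRegularCompleteStructure
import Literature.AlgebraicGeometry.Resolution.PowerSeriesRegularLocal
import HarnessLib

/-!
# The regular model `Λ⟦T₁,…,T_N⟧/(θ′)` of a refined log regular chart (Kato 1994, (3.1), (10.3))

`Literature/AlgebraicGeometry/Resolution/LogRegularRefinementModel.lean`. In Kato's structure
theorem (K. Kato, *Toric singularities*, Amer. J. Math. 116 (1994), (3.1): `𝒪̂ ≅ R[[P]]/(θ)` with
the constant term of `θ` in `𝔪_R ∖ 𝔪_R²`) the refinement of the chart `P` by a free monoid
`ℕ^N ⊇ P` replaces `R[[P]]/(θ)` by `R[[ℕ^N]]/(θ′)`, `θ′` the image of `θ`; this quotient of the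
regular local ring `R⟦T₁,…,T_N⟧` by an element outside `𝔪²` is a REGULAR local ring of
dimension `N` — the completed local ring of the resolved chart (Kato (10.3): "`X′` is regular").
PROVED here:

* `constantCoeff_pushforward` — the push-forward `R⟦P⟧ → R⟦T⟧` along `c` with
  `c p = 0 ⇒ p = 0` preserves constant coefficients (so `θ′` has constant term `π` as well);
* `isRegularLocalRing_model_dvr` — for a Noetherian local domain `Λ` with `𝔪_Λ = (π)`, `π ≠ 0`
  (a DVR) and `θ′ ∈ Λ⟦T₁,…,T_N⟧` with constant coefficient `π`: `Λ⟦T⟧/(θ′)` is regular local of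
  dimension `N`;
* `isRegularLocalRing_model_field` — for a field `K`: `K⟦T₁,…,T_N⟧` is regular local of
  dimension `N` (the tree's `isRegularLocalRing_mvPowerSeries_fin`, restated).

References: [Kato1994] K. Kato, Toric singularities, Amer. J. Math. 116 (1994), (3.1), (10.3);
[Matsumura1987] H. Matsumura, Commutative Ring Theory, Thm. 14.2.
-/

noncomputable section

open IsLocalRing MvPowerSeries Literature.RingTheory.MvPowerSeries
  Literature.RingTheory.MvPowerSeries.monoidPowerSeries

namespace Literature.AlgebraicGeometry.Resolution

namespace LogRegularCompleteStructure

universe u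

/-! ### Constant coefficients under push-forward -/

/-- The push-forward along an exponent map `c` with `c p = 0 ⇒ p = 0` on `P` preserves the
constant coefficient. [cite: Kato1994, (3.1)] -/
theorem constantCoeff_pushforward {σ τ : Type*} {R : Type u} [CommRing R]
    {P : AddSubmonoid (σ →₀ ℕ)} (c : (σ →₀ ℕ) → (τ →₀ ℕ))
    (hfin : ∀ e : τ →₀ ℕ, {p : σ →₀ ℕ | p ∈ P ∧ c p = e}.Finite) (hc0 : c 0 = 0)
    (hadd : ∀ a ∈ P, ∀ b ∈ P, c (a + b) = c a + c b) (hker : ∀ p ∈ P, c p = 0 → p = 0)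
    (f : monoidPowerSeries R P) :
    MvPowerSeries.constantCoeff (pushforward (R := R) c hfin hc0 hadd f : MvPowerSeries τ R) =
      MvPowerSeries.constantCoeff (f : MvPowerSeries σ R) := by
  classical
  rw [← MvPowerSeries.coeff_zero_eq_constantCoeff_apply, coeff_pushforward,
    ← MvPowerSeries.coeff_zero_eq_constantCoeff_apply, Finset.sum_eq_single (0 : σ →₀ ℕ)]
  · intro p hp hp0
    rw [Set.Finite.mem_toFinset, Set.mem_setOf_eq] at hp
    exact (hp0 (hker p hp.1 hp.2)).elim
  · intro h
    exact (h ((Set.Finite.mem_toFinset _).2 ⟨P.zero_mem, hc0⟩)).elim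

/-! ### The model rings -/

/-- **The regular model, DVR coefficients** (Kato (3.1) with (10.3)): for a Noetherian local
domain `Λ` with `𝔪_Λ = (π)`, `π ≠ 0`, and `θ′ ∈ Λ⟦T₁,…,T_N⟧` with constant coefficient `π`, the
ring `Λ⟦T₁,…,T_N⟧/(θ′)` is a regular local ring of dimension `N`.
[cite: Kato1994, (3.1)] [cite: Matsumura1987, Thm. 14.2] -/
theorem isRegularLocalRing_model_dvr {Λ : Type u} [CommRing Λ] [IsLocalRing Λ] [IsDomain Λ]
    [IsNoetherianRing Λ] {π : Λ} (hπ0 : π ≠ 0) (hmax : maximalIdeal Λ = Ideal.span {π})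
    {N : ℕ} (θ' : MvPowerSeries (Fin N) Λ) (hθ' : MvPowerSeries.constantCoeff θ' = π) :
    IsRegularLocalRing (MvPowerSeries (Fin N) Λ ⧸ Ideal.span {θ'}) ∧
      ringKrullDim (MvPowerSeries (Fin N) Λ ⧸ Ideal.span {θ'}) = N := by
  classical
  -- `Λ` is a DVR
  have hnf : ¬IsField Λ := by
    rw [IsLocalRing.isField_iff_maximalIdeal_eq, hmax, Ideal.span_singleton_eq_bot]
    exact hπ0
  have hprinc : (maximalIdeal Λ).IsPrincipal := ⟨⟨π, hmax⟩⟩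
  haveI : IsDiscreteValuationRing Λ := ((IsDiscreteValuationRing.TFAE Λ hnf).out 0 4).mpr hprinc
  haveI : IsRegularLocalRing (MvPowerSeries (Fin N) Λ) :=
    Literature.NumberTheory.GaloisRepresentations.NearlyOrdinaryPresentationCA.isRegularLocalRing_mvPowerSeries_dvr
      Λ N
  have hdimE : ringKrullDim (MvPowerSeries (Fin N) Λ) = (N + 1 : ℕ) :=
    Literature.NumberTheory.GaloisRepresentations.NearlyOrdinaryPresentationCA.ringKrullDim_mvPowerSeries_dvr
      Λ N
  have hπm : π ∈ maximalIdeal Λ := hmax ▸ Ideal.subset_span rfl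
  have hθm : θ' ∈ maximalIdeal (MvPowerSeries (Fin N) Λ) := by
    rw [mem_maximalIdeal, mem_nonunits_iff]
    intro hu
    have h := MvPowerSeries.isUnit_constantCoeff _ hu
    rw [hθ'] at h
    exact ((mem_maximalIdeal _).1 hπm) h
  have hθ2 : θ' ∉ maximalIdeal (MvPowerSeries (Fin N) Λ) ^ 2 :=
    fun h => generator_not_mem_sq hπ0 hmax (hθ' ▸ constantCoeff_mem_sq_of_mem_sq h)
  obtain ⟨hreg, hdim⟩ := IsRegularLocalRing.quotient_span_singleton hθm hθ2
  refine ⟨hreg, ?_⟩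
  haveI := hreg
  obtain ⟨m, hm⟩ := exists_nat_cast_eq_ringKrullDim (R := MvPowerSeries (Fin N) Λ ⧸ Ideal.span {θ'})
  rw [hm, hdimE] at hdim
  rw [hm]
  have h : m + 1 = N + 1 := by exact_mod_cast hdim
  have hmN : m = N := by omega
  rw [hmN]

/-- **The regular model, field coefficients**: `K⟦T₁,…,T_N⟧` is a regular local ring of
dimension `N` (Kato (3.1)(2)/(10.3); tree `isRegularLocalRing_mvPowerSeries_fin`).
[cite: Kato1994, (3.1)] -/
theorem isRegularLocalRing_model_field (K : Type u) [Field K] (N : ℕ) :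
    IsRegularLocalRing (MvPowerSeries (Fin N) K) ∧ ringKrullDim (MvPowerSeries (Fin N) K) = N :=
  isRegularLocalRing_mvPowerSeries_fin K N

end LogRegularCompleteStructure

end Literature.AlgebraicGeometry.Resolution
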